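import Summits.AtomisticToContinuum.HydrodynamicLimit.Theses.ZenoDiameterTransfer

/-!
# Line `bookkeeping_split` — checked skeleton for the crux `DiluteEntropicTwin`
(stmt-AtomisticToContinuum-12207, route ZenoDiameterTransfer, rank 2: the dilute entropic twin)

crux-strategist seat `planner-cstrat-stmt-AtomisticToContinuum-12207-r1-0`, 2026-08-17 (RESTATED re-audit,
BC2 redirect). Line card `Lines/bookkeeping_split.md`; assembly alone: `Cruxes/DiluteEntropicTwin/Split.lean`.

## The line

The crux asks for a dilute hard-sphere twin of a classical ideal Euler solution whose fields follow it AND whose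
law stays entropically in local equilibrium. Its informal content is a proof outline: "DHM Thm 3 for canonical
data (diagonal sequence) + the exact bookkeeping identity H(f_s|ψ_s)/N = E_{f₀}Λ₀ − E_{f_s}Λ_s + N⁻¹log(Z_s/Z₀)
+ isentropy + N⁻¹ log Z_N → log ∫ρ'_s = 0". The line types that outline as FIVE stubs — each a genuine lemma,
none the crux reworded — and proves the composition:

* `stub_diluteFieldTwin`      (X1, OPEN: DHM-type dilute FIELD twin — the crux minus its entropy clause);
* `stub_twinEntropyIdentity`  (X2, M: the exact identity along the twin flow, every N, every s; Liouville);
* `stub_twinTiltLimit`        (X3, M: LLN for the tilt functional; UI from energy conservation);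
* `stub_idealIsentropy`       (X4, L/known: classical ideal Euler conserves ∫∫ M log M);
* `stub_twinPartitionAsymptotics` (X5, M: (N+1)ε³ → 0 ∧ ∫ρ'_s = 1 ⇒ (N+1)⁻¹ log Z_N(s) → 0).

`DiluteEntropicTwin_of : X1 → X2 → X3 → X4 → X5 → DiluteEntropicTwin` is kernel-checked below (sorry-free; the
sorries live only in the five `stub_*`): twin extraction, unit mass at every pre-shock `s` PROVED from the field
convergence under the probability twin laws (`χ ≡ 1`), X3 at `0`/`s` and X5 at `s`/`0` cancelled through X4 and
pushed through `ENNReal.ofReal` onto X2. The same five statements are staged as the route-level split of the crux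
(`SPLIT-REQUEST.md`, children.json): when the split is applied the stubs become the items
`DiluteFieldTwin`, `TwinEntropyIdentity`, `TwinTiltLimit`, `IdealIsentropy`, `TwinPartitionAsymptotics`.

Notation (inlined in every statement): `g_s = localGibbsProfile (ρ' s) (u' s) (θ' s)`; `Q_s^N = particleLaw
(Φ' N) (canonicalDensity 𝕋³ (ε' N) (N+1) g_s)` (canonical local Gibbs law with the time-`s` profiles);
`P_s^N = (Φ' N).lawAt Q_0^N s` (the twin's law at time `s`); `Z_N(s) = canonicalPartition 𝕋³ (ε' N) (N+1) g_s`;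
`Λ_s(z)` = per-particle tilt `(N+1)⁻¹ Σᵢ log g_s(zᵢ)` written through the three empirical fields;
`𝓗(s) = ∫ ρ'_s (log ρ'_s − 3/2 log(2πθ'_s) − 3/2)`.

Disproof used: none relevant (no `Cruxes/DiluteEntropicTwin/Disproof.lean` exists; the refuter one-shot
crux-attack 12207-0 SURVIVES, Evidence12207.lean: hypotheses satisfiable, probability hypothesis load-bearing —
honoured: X1 keeps the probability clause, X2/X5 consume it).
-/

namespace Summit.AtomisticToContinuum.HydrodynamicLimit.Cruxes.DiluteEntropicTwin.BookkeepingSplit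

open scoped BigOperators Topology ENNReal
open Filter Set MeasureTheory
open Summit.AtomisticToContinuum.HydrodynamicLimit.Theses.ZenoDiameterTransfer

/-! ## The five stubs (registered; sorries ONLY here) -/

/-- X1 — DILUTE FIELD TWIN (open; DHM arXiv:2503.01800 Thm 3 (2) for canonical local-Gibbs data, one diagonal dilute sequence, fields at every s < T'). The crux minus its entropy clause. -/
theorem stub_diluteFieldTwin :
    ∀ (T' : ℝ) (ρ' θ' : ℝ → Literature.MathematicalPhysics.KineticTheory.T3 → ℝ) (u' : ℝ → Literature.MathematicalPhysics.KineticTheory.T3 → Literature.MathematicalPhysics.KineticTheory.V3), Literature.MathematicalPhysics.KineticTheory.IsHardSphereEulerSolution 0 T' ρ' u' θ' → 0 < T' → (∫ x, ρ' 0 x = 1) → ∃ ε' : ℕ → ℝ, (∀ N : ℕ, 0 < ε' N ∧ ε' N < 2⁻¹) ∧ Filter.Tendsto (fun N : ℕ => ((N : ℝ) + 1) * ε' N ^ 3) Filter.atTop (nhds 0) ∧ Filter.Tendsto (fun N : ℕ => ((N : ℝ) + 1) * ε' N ^ 2) Filter.atTop Filter.atTop ∧ ∃ Φ' : (N : ℕ)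 → Literature.Analysis.FluidPDE.HardSphereFlow (Literature.Analysis.FluidPDE.Torus.geometry (Fin 3)) (ε' N) (N + 1), (∀ N : ℕ, MeasureTheory.IsProbabilityMeasure (Literature.Analysis.FluidPDE.particleLaw (Φ' N) (Literature.Analysis.FluidPDE.canonicalDensity (Literature.Analysis.FluidPDE.Torus.geometry (Fin 3)) (ε' N) (N + 1) (Literature.MathematicalPhysics.KineticTheory.localGibbsProfile (ρ' 0) (u' 0) (θ' 0))))) ∧ (∀ s ∈ Set.Ico 0 T', Literature.MathematicalPhysics.KineticTheory.TendstoHydroFieldsAt (fun N => (Literature.Analysis.FluidPDE.particleLaw (Φ' N) (Literature.Analysis.FluidPDE.canonicalDensity (Literature.Analysis.FluidPDE.Torus.geometry (Fin 3)) (ε' N) (N + 1) (Literature.MathematicalPhysics.KineticTheory.localGibbsProfile (ρ' 0) (u' 0) (θ' 0))))) Φ' ρ' u' θ' s) := by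
  sorry

/-- X2 — ENTROPY BOOKKEEPING IDENTITY along the twin flow (every N, every s; transport of densities on the good set + Liouville invariance of ∫ f log f + f₀ = ψ₀; Yau 1991 §2, Saint-Raymond 2009 Lemma 3.1.1). -/
theorem stub_twinEntropyIdentity :
    ∀ (T' : ℝ) (ρ' θ' : ℝ → Literature.MathematicalPhysics.KineticTheory.T3 → ℝ) (u' : ℝ → Literature.MathematicalPhysics.KineticTheory.T3 → Literature.MathematicalPhysics.KineticTheory.V3), Literature.MathematicalPhysics.KineticTheory.IsHardSphereEulerSolution 0 T' ρ' u' θ' → ∀ ε' : ℕ → ℝ, (∀ N : ℕ, 0 < ε' N ∧ ε' N < 2⁻¹) → ∀ Φ' : (N : ℕ) → Literature.Analysis.FluidPDE.HardSphereFlow (Literature.Analysis.FluidPDE.Torus.geometry (Fin 3)) (ε' N) (N + 1), (∀ N : ℕ, MeasureTheory.IsProbabilityMeasure (Literature.Analysis.FluidPDE.particleLaw (Φ' N) (Literature.Analysis.FluidPDE.canonicalDensity (Literature.Analysis.FluidPDE.Torus.geometry (Fin 3)) (ε' N) (N + 1) (Literature.MathematicalPhysics.KineticTheory.localGibbsProfile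 (ρ' 0) (u' 0) (θ' 0))))) → ∀ N : ℕ, ∀ s ∈ Set.Ico 0 T', InformationTheory.klDiv ((Φ' N).lawAt (Literature.Analysis.FluidPDE.particleLaw (Φ' N) (Literature.Analysis.FluidPDE.canonicalDensity (Literature.Analysis.FluidPDE.Torus.geometry (Fin 3)) (ε' N) (N + 1) (Literature.MathematicalPhysics.KineticTheory.localGibbsProfile (ρ' 0) (u' 0) (θ' 0)))) s) (Literature.Analysis.FluidPDE.particleLaw (Φ' N) (Literature.Analysis.FluidPDE.canonicalDensity (Literature.Analysis.FluidPDE.Torus.geometry (Fin 3)) (ε' N) (N + 1) (Literature.MathematicalPhysics.KineticTheory.localGibbsProfile (ρ' s) (u' s) (θ' s)))) / ((N : ENNReal) + 1) = ENNReal.ofReal ((∫ z, (Literature.MathematicalPhysics.KineticTheory.empiricalDensityField z (fun x => Real.log (ρ' 0 x) - 3 / 2 * Real.log (2 * Real.pi * θ' 0 x) - ‖u' 0 x‖ ^ 2 / (2 * θ' 0 x)) + (∑ k : Fin 3, Literature.MathematicalPhysics.KineticTheory.empiricalMomentumField z (fun x => (u' 0 x) k / θ' 0 x) k) - Literature.MathematicalPhysics.KineticTheory.empiricalEnergyField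 z (fun x => (θ' 0 x)⁻¹)) ∂((Φ' N).lawAt (Literature.Analysis.FluidPDE.particleLaw (Φ' N) (Literature.Analysis.FluidPDE.canonicalDensity (Literature.Analysis.FluidPDE.Torus.geometry (Fin 3)) (ε' N) (N + 1) (Literature.MathematicalPhysics.KineticTheory.localGibbsProfile (ρ' 0) (u' 0) (θ' 0)))) 0)) - (∫ z, (Literature.MathematicalPhysics.KineticTheory.empiricalDensityField z (fun x => Real.log (ρ' s x) - 3 / 2 * Real.log (2 * Real.pi * θ' s x) - ‖u' s x‖ ^ 2 / (2 * θ' s x)) + (∑ k : Fin 3, Literature.MathematicalPhysics.KineticTheory.empiricalMomentumField z (fun x => (u' s x) k / θ' s x) k) - Literature.MathematicalPhysics.KineticTheory.empiricalEnergyField z (fun x => (θ' s x)⁻¹)) ∂((Φ' N).lawAt (Literature.Analysis.FluidPDE.particleLaw (Φ' N) (Literature.Analysis.FluidPDE.canonicalDensity (Literature.Analysis.FluidPDE.Torus.geometry (Fin 3)) (ε' N) (N + 1) (Literature.MathematicalPhysics.KineticTheory.localGibbsProfile (ρ' 0) (u' 0) (θ' 0)))) s)) + (Real.log (Literature.Analysis.FluidPDE.canonicalPartition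 (Literature.Analysis.FluidPDE.Torus.geometry (Fin 3)) (ε' N) (N + 1) (Literature.MathematicalPhysics.KineticTheory.localGibbsProfile (ρ' s) (u' s) (θ' s))) / ((N : ℝ) + 1) - Real.log (Literature.Analysis.FluidPDE.canonicalPartition (Literature.Analysis.FluidPDE.Torus.geometry (Fin 3)) (ε' N) (N + 1) (Literature.MathematicalPhysics.KineticTheory.localGibbsProfile (ρ' 0) (u' 0) (θ' 0))) / ((N : ℝ) + 1))) := by
  sorry

/-- X3 — LLN FOR THE TILT: fields in probability at s ⇒ E_{P_s}Λ_s → 𝓗(s) (uniform integrability of the kinetic energy per particle: energy conservation on good orbits + Gaussian moments at time 0). -/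
theorem stub_twinTiltLimit :
    ∀ (T' : ℝ) (ρ' θ' : ℝ → Literature.MathematicalPhysics.KineticTheory.T3 → ℝ) (u' : ℝ → Literature.MathematicalPhysics.KineticTheory.T3 → Literature.MathematicalPhysics.KineticTheory.V3), Literature.MathematicalPhysics.KineticTheory.IsHardSphereEulerSolution 0 T' ρ' u' θ' → ∀ ε' : ℕ → ℝ, (∀ N : ℕ, 0 < ε' N ∧ ε' N < 2⁻¹) → ∀ Φ' : (N : ℕ) → Literature.Analysis.FluidPDE.HardSphereFlow (Literature.Analysis.FluidPDE.Torus.geometry (Fin 3)) (ε' N) (N + 1), (∀ N : ℕ, MeasureTheory.IsProbabilityMeasure (Literature.Analysis.FluidPDE.particleLaw (Φ' N) (Literature.Analysis.FluidPDE.canonicalDensity (Literature.Analysis.FluidPDE.Torus.geometry (Fin 3)) (ε' N) (N + 1) (Literature.MathematicalPhysics.KineticTheory.localGibbsProfile (ρ' 0) (u' 0) (θ' 0))))) → ∀ s ∈ Set.Ico 0 T', Literature.MathematicalPhysics.KineticTheory.TendstoHydroFieldsAt (fun N => (Literature.Analysis.FluidPDE.particleLaw (Φ' N) (Literature.Analysis.FluidPDE.canonicalDensity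 (Literature.Analysis.FluidPDE.Torus.geometry (Fin 3)) (ε' N) (N + 1) (Literature.MathematicalPhysics.KineticTheory.localGibbsProfile (ρ' 0) (u' 0) (θ' 0))))) Φ' ρ' u' θ' s → Filter.Tendsto (fun N : ℕ => (∫ z, (Literature.MathematicalPhysics.KineticTheory.empiricalDensityField z (fun x => Real.log (ρ' s x) - 3 / 2 * Real.log (2 * Real.pi * θ' s x) - ‖u' s x‖ ^ 2 / (2 * θ' s x)) + (∑ k : Fin 3, Literature.MathematicalPhysics.KineticTheory.empiricalMomentumField z (fun x => (u' s x) k / θ' s x) k) - Literature.MathematicalPhysics.KineticTheory.empiricalEnergyField z (fun x => (θ' s x)⁻¹)) ∂((Φ' N).lawAt (Literature.Analysis.FluidPDE.particleLaw (Φ' N) (Literature.Analysis.FluidPDE.canonicalDensity (Literature.Analysis.FluidPDE.Torus.geometry (Fin 3)) (ε' N) (N + 1) (Literature.MathematicalPhysics.KineticTheory.localGibbsProfile (ρ' 0) (u' 0) (θ' 0)))) s))) Filter.atTop (nhds (∫ x, ρ' s x * (Real.log (ρ' s x) - 3 / 2 * Real.log (2 * Real.pi * θ' s x) - 3 / 2)))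 := by
  sorry

/-- X4 — ISENTROPY of classical ideal-gas Euler flow: 𝓗(s) = 𝓗(0) (Majda 1984 §1.1; torus divergence theorem in tree). -/
theorem stub_idealIsentropy :
    ∀ (T' : ℝ) (ρ' θ' : ℝ → Literature.MathematicalPhysics.KineticTheory.T3 → ℝ) (u' : ℝ → Literature.MathematicalPhysics.KineticTheory.T3 → Literature.MathematicalPhysics.KineticTheory.V3), Literature.MathematicalPhysics.KineticTheory.IsHardSphereEulerSolution 0 T' ρ' u' θ' → ∀ s ∈ Set.Ico 0 T', (∫ x, ρ' s x * (Real.log (ρ' s x) - 3 / 2 * Real.log (2 * Real.pi * θ' s x) - 3 / 2)) = (∫ x, ρ' 0 x * (Real.log (ρ' 0 x) - 3 / 2 * Real.log (2 * Real.pi * θ' 0 x) - 3 / 2)) := by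
  sorry

/-- X5 — DILUTE PARTITION ASYMPTOTICS: (N+1)ε³ → 0, ∫ρ'_s = 1, non-null domain ⇒ (N+1)⁻¹ log Z_N(s) → 0 (Ruelle 1969 §3.4-type free-volume bounds). -/
theorem stub_twinPartitionAsymptotics :
    ∀ (T' : ℝ) (ρ' θ' : ℝ → Literature.MathematicalPhysics.KineticTheory.T3 → ℝ) (u' : ℝ → Literature.MathematicalPhysics.KineticTheory.T3 → Literature.MathematicalPhysics.KineticTheory.V3), Literature.MathematicalPhysics.KineticTheory.IsHardSphereEulerSolution 0 T' ρ' u' θ' → ∀ ε' : ℕ → ℝ, (∀ N : ℕ, 0 < ε' N ∧ ε' N < 2⁻¹) → Filter.Tendsto (fun N : ℕ => ((N : ℝ) + 1) * ε' N ^ 3) Filter.atTop (nhds 0) → ∀ Φ' : (N : ℕ) → Literature.Analysis.FluidPDE.HardSphereFlow (Literature.Analysis.FluidPDE.Torus.geometry (Fin 3)) (ε' N) (N + 1), (∀ N : ℕ, MeasureTheory.IsProbabilityMeasure (Literature.Analysis.FluidPDE.particleLaw (Φ' N) (Literature.Analysis.FluidPDE.canonicalDensity (Literature.Analysis.FluidPDE.Torus.geometry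 (Fin 3)) (ε' N) (N + 1) (Literature.MathematicalPhysics.KineticTheory.localGibbsProfile (ρ' 0) (u' 0) (θ' 0))))) → ∀ s ∈ Set.Ico 0 T', (∫ x, ρ' s x = 1) → Filter.Tendsto (fun N : ℕ => Real.log (Literature.Analysis.FluidPDE.canonicalPartition (Literature.Analysis.FluidPDE.Torus.geometry (Fin 3)) (ε' N) (N + 1) (Literature.MathematicalPhysics.KineticTheory.localGibbsProfile (ρ' s) (u' s) (θ' s))) / ((N : ℝ) + 1)) Filter.atTop (nhds 0) := by
  sorry

/-! ## Composition (kernel-checked; the only sorries in its cone are the five registered stubs) -/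

/-- **The crux from the five stubs** (each used by name; the composition itself is sorry-free — the
hypotheses form with the stub statements inlined is `Cruxes/DiluteEntropicTwin/Split.lean`,
`DiluteEntropicTwin_of_subs`, axioms propext/choice/Quot.sound). Twin from X1; unit mass at every pre-shock
`s` from the field convergence under the probability twin laws (`χ ≡ 1`); X3 at `0`/`s`, X5 at `s`/`0`,
cancelled through X4, pushed through `ENNReal.ofReal` onto the identity X2. -/
theorem DiluteEntropicTwin_of : DiluteEntropicTwin := by
  have h₁ := stub_diluteFieldTwin
  have h₂ := stub_twinEntropyIdentity
  have h₃ := stub_twinTiltLimit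
  have h₄ := stub_idealIsentropy
  have h₅ := stub_twinPartitionAsymptotics
  intro T' ρ' θ' u' hE hT hmass
  obtain ⟨ε', hε', h3, h2, Φ', hprob, hconv⟩ := h₁ T' ρ' θ' u' hE hT hmass
  refine ⟨ε', hε', h3, h2, Φ', hprob, hconv, ?_⟩
  intro s hs
  have h0 : (0 : ℝ) ∈ Set.Ico 0 T' := ⟨le_rfl, hT⟩
  -- Step 1 (mass normalisation at time `s`, test function χ ≡ 1 under the probability twin laws).
  have hmass_s : ∫ x, ρ' s x = 1 := by
    by_contra hne
    have habs : 0 < |1 - ∫ x, ρ' s x| := abs_pos.mpr (sub_ne_zero.mpr (Ne.symm hne))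
    obtain ⟨hd, -, -⟩ := hconv s hs (fun _ => (1 : ℝ)) continuous_const (|1 - ∫ x, ρ' s x| / 2)
      (half_pos habs)
    have hconst : ∀ N : ℕ,
        (Literature.Analysis.FluidPDE.particleLaw (Φ' N)
          (Literature.Analysis.FluidPDE.canonicalDensity (Literature.Analysis.FluidPDE.Torus.geometry (Fin 3))
            (ε' N) (N + 1)
            (Literature.MathematicalPhysics.KineticTheory.localGibbsProfile (ρ' 0) (u' 0) (θ' 0))))
          {z | |1 - ∫ x, ρ' s x| / 2 <
            |Literature.MathematicalPhysics.KineticTheory.empiricalDensityField ((Φ' N).flow s z)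
                (fun _ => (1 : ℝ)) - ∫ x, (fun _ => (1 : ℝ)) x * ρ' s x|} = 1 := by
      intro N
      haveI := hprob N
      have hset : {z : Literature.Analysis.FluidPDE.Config (N + 1) (Fin 3)
          Literature.MathematicalPhysics.KineticTheory.T3 | |1 - ∫ x, ρ' s x| / 2 <
            |Literature.MathematicalPhysics.KineticTheory.empiricalDensityField ((Φ' N).flow s z)
                (fun _ => (1 : ℝ)) - ∫ x, (fun _ => (1 : ℝ)) x * ρ' s x|} = Set.univ := by
        refine Set.eq_univ_of_forall fun z => ?_
        simp only [Set.mem_setOf_eq, one_mul,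
          Literature.MathematicalPhysics.KineticTheory.empiricalDensityField_one (Nat.succ_ne_zero N)]
        exact half_lt_self habs
      rw [hset, measure_univ]
    have hlim : Filter.Tendsto (fun _ : ℕ => (1 : ℝ≥0∞)) Filter.atTop (nhds 0) :=
      hd.congr' (Filter.Eventually.of_forall hconst)
    exact one_ne_zero (tendsto_nhds_unique tendsto_const_nhds hlim)
  -- Step 2 (the four limits).
  have hA := h₃ T' ρ' θ' u' hE ε' hε' Φ' hprob 0 h0 (hconv 0 h0)
  have hB := h₃ T' ρ' θ' u' hE ε' hε' Φ' hprob s hs (hconv s hs)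
  have hC := h₅ T' ρ' θ' u' hE ε' hε' h3 Φ' hprob s hs hmass_s
  have hD := h₅ T' ρ' θ' u' hE ε' hε' h3 Φ' hprob 0 h0 hmass
  have hiso := h₄ T' ρ' θ' u' hE s hs
  -- Step 3 (bookkeeping identity + limit algebra).
  have hlim := ENNReal.tendsto_ofReal ((hA.sub hB).add (hC.sub hD))
  rw [hiso, sub_self, sub_self, add_zero, ENNReal.ofReal_zero] at hlim
  refine hlim.congr' (Filter.Eventually.of_forall fun N => ?_)
  exact (h₂ T' ρ' θ' u' hE ε' hε' Φ' hprob N s hs).symm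

end Summit.AtomisticToContinuum.HydrodynamicLimit.Cruxes.DiluteEntropicTwin.BookkeepingSplit
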